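/-
Copyright (c) 2026 the pub-hodgecm-mathlib formalisation cell (harness21).  Prover seat hodgecm-mathlib-LH4-p18 (g4), req620 Track A «(D-RAM) FOUR-FRAME» squad
(STAGE-1b, row (2) of the piece `f_{T₊}`, the (β₂) road (R-36) «PURE-CELL LEDGER»; K6 desk LH4-p16 (g3) WORD #1 (c) «F1 = THE ROW TOWER CELL SOCKET INSTANCE, OWNER LH4-p18»;
F1b = the cell half: ★ K6-0 HEAD′ instantiated), 2026-09-05.
-/
import Summits.HodgeConjecture.HodgeConjecture.Theorems.F0P3cDyRamRowTowerVertexLetters            -- ★ F1a (this seat): `rowTower_vertex_letters` (shells + presentation + glue + coordinate + ★ M1 label); brings the MASTER's vocabulary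
import Summits.HodgeConjecture.HodgeConjecture.Theorems.F0P3cDyRamConeCellPerCellLaw                -- ★ K6-0 p864195 (this seat): HEAD′ `cellDiff_mul_card_eq_cellCount_mul_signSum_of_fibration_reads₃`, `ite_eq_normSign_mul_normSign`
import Summits.HodgeConjecture.HodgeConjecture.Theorems.F0P3cDyRamRowCellSocketFibre                -- ★ p864078 (this seat): (hF) `fibre_ncard_eq_of_lit_of_gen`; brings ★ p863983 (hLit), ★ p863914 (hV)(hP)(hL-const)
import Summits.HodgeConjecture.HodgeConjecture.Theorems.F0P3cDyRamRowCellGeneratorIndependence       -- ★ p864148 (LH7-p06 (g3)): (hI) `cls_iff_cls_and_v_sub_le_of_gen`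
import Summits.HodgeConjecture.HodgeConjecture.Theorems.F0P3cDyRamConeCellGluedVertexExistsOfWeight -- ★ p864081 (LH7-p10 (g3)): `exists_glued_of_mem_levelSetDep_of_weight_ne_zero`
import Summits.HodgeConjecture.HodgeConjecture.Theorems.F0P3cDyRamConeCellLedgerSizes               -- ★ (LH4-p12 lineage): `levelSetDep_eq_levelSet_of_add_le` (the row's `hcell`)
import Literature.NumberTheory.LocalFields.WildQuadraticDatumNormSignConductor                   -- ★ Lit: `normSign_eq_of_near` (the norm-residue sign is constant on `1 + 𝔭^{2d−1}`-cosets)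
import HarnessLib

/-!
# Crux `H413`, line LH4 «(D-RAM) FOUR-FRAME» — STAGE-1b, row (2), the (β₂) road (R-36), K6 road F1b: «THE PER-CELL VALUE OF A ROW TOWER CELL» — ★ K6-0 HEAD′ (p864195)
# INSTANTIATED on an inside cell `(j, b)` of the live row `2b = m` (`d` even), in ‹OFF.letter.v1›'s literal-set currency: `X(j,b)·#(Rd.filter LIT) = n(j,b)·(ω(−h_W)·Σ_{V} ω(α₁ + γ₁V))`

Cell `hodgecm-mathlib` (D-0151), FLOOR 0, crux item H413 = `stmt-HodgeConjecture-24833`, route of record `HCCMUnconditional`; squad F0∕P3c∕LH4; lane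
`--supports stmt-HodgeConjecture-24833 --as helper` (count-neutral; pays NO tier-0 row).  THEOREMS ONLY (no `def`, no instance, no notation, no `sorry`, default heartbeats);
★-only imports; states NO law; (β₂) stays a HYPOTHESIS.  Binders = ★ F1a's (block subset BY NAME, row, fence∕deep tokens, `hFgap`, cell, chart `(κ₀, ξ₀, g; μ_a, μ_b, R₀, γ₀; α₁, γ₁, haff)`)
+ the block's weight letter `f hf` and `hfinLS` + the one-field CLASS LETTERS of the frame (`hdeep` at `|jEϖ|^{2d}` for ★ (hI), `c₀ hc₀1 hdich hwit` for ★ (hF) — lane B: ★ LH4-p19 (g3)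
`…RamKFrameClassLetters`) + the DIGIT SYSTEM `Rd ⊂ Fix σ` mod `r` covering `Fix σ ∩ 𝒪` (`hRdσ hRd2 hRd3`) + the PRECISION LETTERS `hrfloor : |jEϖ|^{2b} ≤ r·|ξ₀|·|cc(α−ρα)|` (the SHARP generator tolerance, §1 — weaker than ★ p864148's `|jEϖ|^b ≤ r`), `hrR`, `hr₀`,
`hdeep` at `r₀` ((hLit)∕(hF)), `hrγ : |γ₁|·r ≤ |ϖ|^{2d−1}` (label constancy, §2) + `hα₁σ hα₁1 hγ₁σ hγ₁1` (★ p862927's sizes).  SCOPE (this seat's bus notes 02:13Z∕02:19Z): with the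
sharp floor the precision letters are jointly satisfiable on EVERY inside cell iff `b ≥ 2d − 1` (`r·|ξ₀|·|cc(α−ρα)| ∈ [|ϖ|^{2b}, |ϖ|^{b+2d−1}]`); on the rows `d ≤ b ≤ 2d − 2`
they are not — F1b is stated with the letters explicit and decides nothing there.
WHAT.  With `P₁ Λ`, `Q₁ Λ` := ‹OFF.letter.v1›'s two literal sets of the cell (glued self-dual `L₃ ⊃ B`, tube `b`, shell at `m⋆` resp. `m_c`, `VS_{m⋆} = X₊` resp. `≠`), `X(j,b) :=
Σᶠ_{cell ∩ P₁} f − Σᶠ_{cell ∩ Q₁} f`, `n(j,b) := Σᶠ_{cell} f`, `cell = levelSetDep ρ Θ α (jEϖ) h j b (lam − jE u₀₀)`, and `LIT V₀ :=` ★ p863983's sphere ∧ class conjunction at the chart: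
**`X(j,b) · #(Rd.filter LIT) = n(j,b) · (normSign σ (−h_W) · Σ_{V ∈ (Rd.filter LIT).filter ⊤} normSign σ (α₁ + γ₁·V))`** — ★ K6-0 HEAD′'s RAW bytes (K6 desk WORD #1 (c)(ii); the
dictionary rewrite `Rd.filter LIT = (Rd.filter (|·| = 1)).filter CLASS` of ★ K6-(d) is the consumer's).  MECHANISM: the socket's letters BY NAME — (hV)(hP) ★ p863914, (hLit) ★ p863983,
(hF) ★ p864078, (hI) = ★ p864148's class part + §1, `hcell` ★ `levelSetDep_eq_levelSet_of_add_le` (`2b ≤ m`, `j + b ≤ jl`), (hψ)∕(hNX) label constancy ★ Lit `normSign_eq_of_near`; the reads (hL₁)(hL₂)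
= THE JUNCTION: a weighted member has a glued vertex (★ p864081), every glued vertex is on both shells and reads `VS = X₊ ↔ ω(pw·P)·ω(α₁ + γ₁V₁) = 1` (★ F1a), `ω(pw·P) = ω(−h_W)` on a
weighted member (★ p863914 §3), and the label passes from the presentation's generator `x₁` to any generator `x₀` ((hI)'s digit part + constancy); sign read `hω` = ★ `ite_eq_normSign_mul_normSign`.
WHAT IS NOT CLAIMED: any digit-range bookkeeping, any character-sum value, (f′) uniform density across cells, any census identity; ‹FLIPVAL›∕‹CORE-3› stay OPEN.
HONEST LABEL.  Count-neutral assembly of ★ pieces; nothing printed is asserted; no census law is stated; `HC_CM` is proved only modulo the 7 printed citations (2 remaining named inputs: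
hLiu418 = `stmt-HodgeConjecture-24832`, h413 = `stmt-HodgeConjecture-24833`) until rung 0 closes.
## References
* [Kottwitz1986BaseChangeUnits] R. E. Kottwitz, *Base change for unit elements of Hecke algebras*, Compositio Math. 60 (1986): §1 pp. 240–241 (signed lattice counts cell by cell).
* [LabesseLanglands1979] J.-P. Labesse, R. P. Langlands, *L-indistinguishability for SL(2)*, Canad. J. Math. 31 (1979): §2 (2.2) p. 9 (κ-signed counts).
* [Rogawski1990] J. D. Rogawski, *Automorphic Representations of Unitary Groups in Three Variables*, Ann. of Math. Stud. 123 (1990): §4.9 Prop. 4.9.1 (b) p. 55.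
* [Serre1979] J.-P. Serre, *Local Fields*, GTM 67 (1979): Ch. V §3 Prop. 5, Cor. 2–3; Ch. XV §2; [Jacobowitz1962] R. Jacobowitz, Amer. J. Math. 84 (1962): §4.
-/

set_option autoImplicit false

noncomputable section

namespace Summit.HodgeConjecture.HodgeConjecture.Cruxes.H413.F0P3cDyRamRowTowerCellPerCellValue

open scoped Valued WithZero Matrix MatrixGroups Classical
open WithZero Finset
open Literature.NumberTheory.Automorphic Literature.NumberTheory.Automorphic.HermitianLattice Literature.NumberTheory.Automorphic.UnitaryLatticeTree
open Literature.NumberTheory.Automorphic.UnitaryThreeFourFrame (IsRamifiedQuadraticDatum normSign)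
open Literature.NumberTheory.LocalFields.WildQuadraticDatum (normSign_eq_of_near)
open Literature.NumberTheory.Rogawski1990
open Summit.HodgeConjecture.HodgeConjecture.Cruxes.H413.F0P3cDyRamFourFramePieces
open Summit.HodgeConjecture.HodgeConjecture.Cruxes.H413.F0P3cDyRamFourFrameCensusDefs (LatticeInLevel LatticeNearTransvShell)
open Summit.HodgeConjecture.HodgeConjecture.Cruxes.H413.F0P3cDyRamStageOneBDefs (mcOfRecord)
open Summit.HodgeConjecture.HodgeConjecture.Cruxes.H413.F0P3cDyRamToricCensusDefs
open Summit.HodgeConjecture.HodgeConjecture.Cruxes.H413.F0P3cDyRamRowCellOnShell (uniformizer_letters)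
open Summit.HodgeConjecture.HodgeConjecture.Cruxes.H413.F0P3cDyRamDatumParity (d_le_t_of_even)
open Summit.HodgeConjecture.HodgeConjecture.Cruxes.H413.F0P3cDyRamRowTowerVertexLetters (rowTower_vertex_letters)
open Summit.HodgeConjecture.HodgeConjecture.Cruxes.H413.F0P3cDyRamConeCellPerCellLaw (cellDiff_mul_card_eq_cellCount_mul_signSum_of_fibration_reads₃ ite_eq_normSign_mul_normSign)
open Summit.HodgeConjecture.HodgeConjecture.Cruxes.H413.F0P3cDyRamRowCellSocketFibre (fibre_ncard_eq_of_lit_of_gen)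
open Summit.HodgeConjecture.HodgeConjecture.Cruxes.H413.F0P3cDyRamRowCellSocketLit (lit_of_near_of_gen)
open Summit.HodgeConjecture.HodgeConjecture.Cruxes.H413.F0P3cDyRamRowCellSocketReads (exists_coord_of_gen weight_ne_zero_iff_cls_of_gen weight_ne_zero_iff_normSign_pairing_of_gen)
open Summit.HodgeConjecture.HodgeConjecture.Cruxes.H413.F0P3cDyRamRowVertexPopulationRead (normSign_mul_eq_one_iff_eq)
open Summit.HodgeConjecture.HodgeConjecture.Cruxes.H413.F0P3cDyRamRowCellGeneratorIndependence (cls_iff_cls_of_gen normTheta_gen_mul digit_mul_sub_digit)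
open Summit.HodgeConjecture.HodgeConjecture.Cruxes.H413.F0P3cDyRamDiagonalCellGeneratorChange (exists_isOrd_mul_of_presentations)
open Summit.HodgeConjecture.HodgeConjecture.Cruxes.H413.F0P3cDyRamDiagonalCellGeneratorIndependence (v_eq_one_of_isOrd_of_mul_eq_one)
open Summit.HodgeConjecture.HodgeConjecture.Cruxes.H413.F0P3cDyRamRowVertexCoordinateChange (v_normTheta_sub_map_le)
open Summit.HodgeConjecture.HodgeConjecture.Cruxes.H413.F0P3cDyRamRowCellFibreTransport (trace_letters)
open Summit.HodgeConjecture.HodgeConjecture.Cruxes.H413.F0P3cDyRamConeCellGluedVertexExistsOfWeight (exists_glued_of_mem_levelSetDep_of_weight_ne_zero)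
open Summit.HodgeConjecture.HodgeConjecture.Cruxes.H413.F0P3cDyRamConeCellLedgerSizes (levelSetDep_eq_levelSet_of_add_le)

variable {E M : Type} [Field E] [Valued E ℤᵐ⁰] [Field M] [Valued M ℤᵐ⁰]

/-! ## §1 The SHARP digit part of (hI): the coordinate moves below `|jEϖ|^{2b} ∕ (|ξ₀|·|cc(α−ρα)|)` -/
omit [Valued E ℤᵐ⁰] in
/-- **(hI), DIGIT PART, SHARP FLOOR.**  ★ p864148 `v_coord_sub_coord_le_of_gen` VERBATIM up to its last line: there `|u₀| ≤ |ξ₀|` (the radius letter `hR`) coarsens the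
exact change `|u₀|·|jEϖ|^b ∕ |ξ₀|` of the coordinate to `|jEϖ|^b`; here the floor letter `hr : |jEϖ|^{2b} ≤ r·|ξ₀|·|cc(α−ρα)|` keeps it (`|u₀|·|cc(α−ρα)| = |jEϖ|^b`), so
`|Vf x₀′ − Vf x₀| ≤ r` for ANY socket radius above the cell's own ambiguity — every inside cell of a row `b ≥ 2d − 1` then carries a radius compatible with (hLit)∕(hF).
[cite: Serre1979, Ch. III §6 Prop. 12] [cite: Jacobowitz1962, §4] [cite: Kottwitz1986BaseChangeUnits, §1 pp. 240–241] -/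
theorem v_coord_sub_coord_le_of_floor {ρ Θ : M →+* M} {α : M}
    (jE : E →+* M) (hjfix : ∀ z, ρ z = z ↔ ∃ c, jE c = z) {ϖ : E} (hjϖ0 : jE ϖ ≠ 0) (hjϖ1 : Valued.v (jE ϖ) ≤ 1)
    (hρρ : ∀ x, ρ (ρ x) = x) (hvρ : ∀ x, Valued.v (ρ x) = Valued.v x) (hΘΘ : ∀ x, Θ (Θ x) = x) (hΘρ : ∀ x, Θ (ρ x) = ρ (Θ x))
    (hvΘ : ∀ x, Valued.v (Θ x) = Valued.v x)
    {hM : M} (hΘh : Θ hM = hM) {j b : ℕ} (hb1 : 1 ≤ b) (hcc : jE ϖ ^ j * (α - ρ α) ≠ 0)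
    (hFgap : ∀ z : M, ρ z = z → Θ z = z → Valued.v (jE ϖ) < Valued.v z → Valued.v z ≤ 1 → Valued.v z = 1)
    (κ₀ : M) {ξ₀ : M} (hξ0 : ξ₀ ≠ 0) {r : ℤᵐ⁰} (hr : Valued.v (jE ϖ) ^ (2 * b) ≤ r * Valued.v ξ₀ * Valued.v (jE ϖ ^ j * (α - ρ α)))
    (Λ : AddSubgroup M) (x₀ x₀' : M)
    (hG : x₀ ≠ 0 ∧ (∀ x, x ∈ Λ ↔ ∃ ζ, IsOrd ρ α (jE ϖ ^ j) ζ ∧ x = x₀ * ζ) ∧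
      IsOrd ρ α (jE ϖ ^ j) (dualGen ρ Θ α (jE ϖ ^ j) hM x₀) ∧ ¬ IsOrd ρ α (jE ϖ ^ j) (dualGen ρ Θ α (jE ϖ ^ j) hM x₀ / jE ϖ) ∧
      Valued.v (dualGen ρ Θ α (jE ϖ ^ j) hM x₀) = Valued.v (jE ϖ) ^ b)
    (hG' : x₀' ≠ 0 ∧ (∀ x, x ∈ Λ ↔ ∃ ζ, IsOrd ρ α (jE ϖ ^ j) ζ ∧ x = x₀' * ζ) ∧
      IsOrd ρ α (jE ϖ ^ j) (dualGen ρ Θ α (jE ϖ ^ j) hM x₀') ∧ ¬ IsOrd ρ α (jE ϖ ^ j) (dualGen ρ Θ α (jE ϖ ^ j) hM x₀' / jE ϖ) ∧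
      Valued.v (dualGen ρ Θ α (jE ϖ ^ j) hM x₀') = Valued.v (jE ϖ) ^ b) :
    Valued.v ((ρ (hM * (x₀' * Θ x₀')) / (hM * (x₀' * Θ x₀') + ρ (hM * (x₀' * Θ x₀'))) - κ₀) / ξ₀ -
        (ρ (hM * (x₀ * Θ x₀)) / (hM * (x₀ * Θ x₀) + ρ (hM * (x₀ * Θ x₀))) - κ₀) / ξ₀) ≤ r := by
  -- adapted from ★ p864148 `…RowCellGeneratorIndependence.v_coord_sub_coord_le_of_gen` (LH7-p06 (g3)); only the last estimate differs
  have hρj : ∀ c : E, ρ (jE c) = jE c := fun c => (hjfix _).2 ⟨c, rfl⟩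
  have hccAv : (0 : ℤᵐ⁰) < Valued.v (jE ϖ ^ j * (α - ρ α)) := zero_lt_iff.2 ((Valuation.ne_zero_iff _).2 hcc)
  have hξv : (0 : ℤᵐ⁰) < Valued.v ξ₀ := zero_lt_iff.2 ((Valuation.ne_zero_iff _).2 hξ0)
  obtain ⟨hx₀, hΛ, hyO, hyprim, hylev⟩ := hG
  obtain ⟨hx₀', hΛ', hyO', hyprim', hylev'⟩ := hG'
  obtain ⟨-, -, ht1⟩ := trace_letters (α := α) hρρ hΘΘ hΘρ hΘh (hρj ϖ) hjϖ0 hjϖ1 hb1 hcc hFgap hyO hyprim hylev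
  obtain ⟨-, -, ht'1⟩ := trace_letters (α := α) hρρ hΘΘ hΘρ hΘh (hρj ϖ) hjϖ0 hjϖ1 hb1 hcc hFgap hyO' hyprim' hylev'
  have hu₀v : Valued.v (hM * (x₀ * Θ x₀)) * Valued.v (jE ϖ ^ j * (α - ρ α)) = Valued.v (jE ϖ) ^ b := by
    rw [← Valuation.map_mul, ← dualGen_def, hylev]
  obtain ⟨z, z', hz, hz', hx₀z, hzz'⟩ := exists_isOrd_mul_of_presentations hx₀ hΛ hΛ'
  have hz1 : Valued.v z = 1 := v_eq_one_of_isOrd_of_mul_eq_one hz hz' hzz'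
  have hu₀' : hM * (x₀' * Θ x₀') = hM * (x₀ * Θ x₀) * (z * Θ z) := by rw [hx₀z, normTheta_gen_mul]
  rw [hu₀'] at ht'1 ⊢
  set u₀ : M := hM * (x₀ * Θ x₀) with hu₀def
  set N : M := z * Θ z with hNdef
  have ht0 : u₀ + ρ u₀ ≠ 0 := fun h0 => by rw [h0, map_zero] at ht1; exact zero_ne_one ht1
  have ht'0 : u₀ * N + ρ (u₀ * N) ≠ 0 := fun h0 => by rw [h0, map_zero] at ht'1; exact zero_ne_one ht'1
  have e0 : (ρ (u₀ * N) / (u₀ * N + ρ (u₀ * N)) - κ₀) / ξ₀ - (ρ u₀ / (u₀ + ρ u₀) - κ₀) / ξ₀ =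
      (ρ (u₀ * N) / (u₀ * N + ρ (u₀ * N)) - ρ u₀ / (u₀ + ρ u₀)) / ξ₀ := by ring
  rw [e0, digit_mul_sub_digit hρρ ht0 ht'0, map_div₀, div_le_iff₀ hξv]
  simp only [map_div₀, Valuation.map_mul, hvρ, ht1, ht'1, mul_one, div_one]
  have hskew : Valued.v (ρ N - N) ≤ Valued.v (jE ϖ ^ j * (α - ρ α)) := by
    rw [← Valuation.map_neg, neg_sub, hNdef]
    exact (v_normTheta_sub_map_le hvρ hΘρ hvΘ z).trans (by rw [hz1, mul_one]; exact hz.2)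
  refine le_of_mul_le_mul_right ?_ hccAv
  calc Valued.v u₀ * Valued.v u₀ * Valued.v (ρ N - N) * Valued.v (jE ϖ ^ j * (α - ρ α))
      ≤ Valued.v u₀ * Valued.v u₀ * Valued.v (jE ϖ ^ j * (α - ρ α)) * Valued.v (jE ϖ ^ j * (α - ρ α)) := by gcongr
    _ = Valued.v (jE ϖ) ^ (2 * b) := by rw [mul_assoc (Valued.v u₀), hu₀v, mul_right_comm, hu₀v, ← pow_add, two_mul]
    _ ≤ r * Valued.v ξ₀ * Valued.v (jE ϖ ^ j * (α - ρ α)) := hr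

/-! ## §2 The label sign `ω(α₁ + γ₁·V)` is constant on digits mod `r` once `|γ₁|·r ≤ |ϖ|^{2d−1}` -/
omit [Field M] [Valued M ℤᵐ⁰] in
/-- **LABEL CONSTANCY.**  For the wild datum and `σ`-fixed `α₁, γ₁` with `|α₁| = 1`, `|γ₁| < 1`, and `|γ₁|·r ≤ |ϖ|^{2d−1}`: two `σ`-fixed `V, V′` with `|V| ≤ 1` and `|V − V′| ≤ r`
have `normSign σ (α₁ + γ₁V′) = normSign σ (α₁ + γ₁V)` (★ Lit `normSign_eq_of_near`: the sign is constant on `1 + 𝔭^{2d−1}`-cosets of units). [cite: Serre1979, Ch. V §3 Cor. 3; Ch. XV §2] -/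
theorem normSign_affine_eq_of_sub_le [CompleteSpace E] {σ : E →+* E} {ϖ : E} {d tE : ℕ} (hD : IsRamifiedQuadraticDatum σ ϖ d tE)
    {α₁ γ₁ : E} (hα₁σ : σ α₁ = α₁) (hα₁1 : Valued.v α₁ = 1) (hγ₁σ : σ γ₁ = γ₁) (hγ₁1 : Valued.v γ₁ < 1)
    {r : ℤᵐ⁰} (hrγ : Valued.v γ₁ * r ≤ Valued.v ϖ ^ (2 * d - 1))
    {V V' : E} (hσV : σ V = V) (hV1 : Valued.v V ≤ 1) (hσV' : σ V' = V') (hVV' : Valued.v (V - V') ≤ r) :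
    normSign σ (α₁ + γ₁ * V') = normSign σ (α₁ + γ₁ * V) := by
  have hg1 : Valued.v (α₁ + γ₁ * V) = 1 := by
    have hlt : Valued.v (γ₁ * V) < Valued.v α₁ := by
      rw [hα₁1, Valuation.map_mul]; exact (mul_le_of_le_one_right' hV1).trans_lt hγ₁1
    rw [Valuation.map_add_eq_of_lt_left _ hlt, hα₁1]
  have hσg : σ (α₁ + γ₁ * V) = α₁ + γ₁ * V := by rw [map_add, map_mul, hα₁σ, hγ₁σ, hσV]
  have hσg' : σ (α₁ + γ₁ * V') = α₁ + γ₁ * V' := by rw [map_add, map_mul, hα₁σ, hγ₁σ, hσV']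
  have hnear : Valued.v ((α₁ + γ₁ * V) - (α₁ + γ₁ * V')) ≤ Valued.v ϖ ^ (2 * d - 1) := by
    rw [show (α₁ + γ₁ * V) - (α₁ + γ₁ * V') = γ₁ * (V - V') by ring, Valuation.map_mul]
    exact (mul_le_mul' le_rfl hVV').trans hrγ
  exact normSign_eq_of_near hD hσg hσg' hg1 le_rfl hnear

/-! ## §3 HEAD — ★ K6-0 HEAD′ on a row tower cell -/
/-- **HEAD — «THE PER-CELL VALUE OF A ROW TOWER CELL» (F1b).**  ★ F1a's binders + the weight letter `f hf` and `hfinLS` of ‹OFF.letter.v1› + the class letters (`hdeep₂` at `|jEϖ|^{2d}`,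
`c₀ hc₀1 hdich hwit`) + the digit system `Rd` (`σ`-fixed `hRdσ`, covering `hRd2`, separated `hRd3` mod `r`) + the precision letters `hrb hrR hr₀ hdeep hrγ` + the sizes of `α₁ γ₁`.
THEN ★ K6-0 HEAD′'s conclusion with `P₁ Q₁ :=` the two literal sets, `LIT :=` ★ p863983's conjunction, `NX := ⊤`, `p := normSign σ (−h_W)`, `ω V := normSign σ (α₁ + γ₁·V)`.
[cite: Kottwitz1986BaseChangeUnits, §1 pp. 240–241] [cite: LabesseLanglands1979, §2 (2.2) p. 9] [cite: Rogawski1990, §4.9 Prop. 4.9.1 (b) p. 55] [cite: Serre1979, Ch. V §3 Cor. 3; Ch. XV §2] -/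
theorem rowTower_cellDiff_mul_card_eq [CompleteSpace E] [IsDiscreteValuationRing 𝒪[E]] [Finite 𝓀[E]]
    (σ : E →+* E) (ϖ : E) (d tE : ℕ) (hD : IsRamifiedQuadraticDatum σ ϖ d tE)
    (jE : E →+* M) (ρ Θ : M →+* M) (α lam : M)
    (hρρ : ∀ z, ρ (ρ z) = z) (hvρ : ∀ z, Valued.v (ρ z) = Valued.v z)
    (hjv : ∀ a, Valued.v (jE a) ≤ 1 ↔ Valued.v a ≤ 1) (hjfix : ∀ z : M, ρ z = z ↔ ∃ a, jE a = z) (hΘj : ∀ a, Θ (jE a) = jE (σ a))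
    (hΘΘ : ∀ z, Θ (Θ z) = z) (hΘρ : ∀ z, Θ (ρ z) = ρ (Θ z)) (hvΘ : ∀ z, Valued.v (Θ z) = Valued.v z)
    (hα : ρ α ≠ α) (hα1 : Valued.v α ≤ 1) (hint : ∀ z : M, Valued.v z ≤ 1 → Valued.v ((z - ρ z) / (α - ρ α)) ≤ 1)
    (hvlam : Valued.v lam = 1) (hU : Valued.v (α - ρ α) = 1) (hjiso : ∀ a, Valued.v (jE a) = Valued.v a)
    (hjpow : ∀ (t : E) (n : ℤ), Valued.v (jE t) = Valued.v (jE ϖ) ^ n ↔ Valued.v t = Valued.v ϖ ^ n)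
    (hϖmax : ∀ t : M, ρ t = t → Valued.v t < 1 → Valued.v t ≤ Valued.v (jE ϖ))
    (γ₂ : GL (Fin 2) E) (u : GL (Fin 1) E) (m jl : ℕ) (hm : Valued.v (lam - jE ((u : Matrix (Fin 1) (Fin 1) E) 0 0)) = WithZero.exp (-(m : ℤ)))
    (hjl : Valued.v ((lam - jE ((u : Matrix (Fin 1) (Fin 1) E) 0 0)) - ρ (lam - jE ((u : Matrix (Fin 1) (Fin 1) E) 0 0))) = WithZero.exp (-(jl : ℤ)))
    (hum : Valued.v (((u : Matrix (Fin 1) (Fin 1) E) 0 0) - 1) ≤ Valued.v (ϖ ^ mstarOfRecord d))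
    (H₂ : Matrix (Fin 2) (Fin 2) E) (hW : E) (hH₂ : IsUnit H₂.det) (hH₂σ : (H₂.map σ)ᵀ = H₂) (hhW : Valued.v hW = 1) (hhWσ : σ hW = hW)
    (φ : (Fin 2 → E) →+ M) (h : M) (hφs : ∀ (c : E) (x : Fin 2 → E), φ (c • x) = jE c * φ x) (hφi : Function.Injective φ) (hφo : Function.Surjective φ)
    (hφγ : ∀ x, φ ((γ₂ : Matrix (Fin 2) (Fin 2) E).mulVec x) = lam * φ x)
    (hform : ∀ x y, jE (pairing σ H₂ x y) = h * Θ (φ x) * φ y + ρ (h * Θ (φ x) * φ y)) (hΘh : Θ h = h) (hh : h ≠ 0)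
    (f : ℕ → ℕ → AddSubgroup M → ℕ)
    (hf : ∀ (b j : ℕ) (Λ : AddSubgroup M) (x₀ : M) (r : E), 1 ≤ b → x₀ ≠ 0 → (∀ x, x ∈ Λ ↔ ∃ z, IsOrd ρ α (jE ϖ ^ j) z ∧ x = x₀ * z) →
      IsOrd ρ α (jE ϖ ^ j) (dualGen ρ Θ α (jE ϖ ^ j) h x₀) → ¬ IsOrd ρ α (jE ϖ ^ j) (dualGen ρ Θ α (jE ϖ ^ j) h x₀ / jE ϖ) → Valued.v (dualGen ρ Θ α (jE ϖ ^ j) h x₀) = Valued.v (jE ϖ) ^ b →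
      (∀ b', (∀ x ∈ Λ, Valued.v (h * Θ x * b' + ρ (h * Θ x * b')) ≤ 1) → (lam - jE ((u : Matrix (Fin 1) (Fin 1) E) 0 0)) * b' ∈ Λ) → IsOrd ρ α (jE ϖ ^ j) lam →
      jE r = glueUnit ρ Θ α (jE ϖ ^ j) h (jE ϖ) (jE hW) x₀ b →
      f b j Λ = Nat.card {x : 𝒪[E] ⧸ 𝓂[E] ^ (2 * b) // ∃ u' : 𝒪[E], Ideal.Quotient.mk (𝓂[E] ^ (2 * b)) u' = x ∧ Valued.v ((u' : E) * σ u' - r) ≤ Valued.v (ϖ ^ (2 * b))})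
    (hfinLS : ∀ j a, (levelSet ρ Θ α (jE ϖ) h j a).Finite)
    (b : ℕ) (hb2 : 2 * b = m) (hd0 : d % 2 = 0)
    (hΘlam : Θ lam * lam = 1) (P₁ : GL (Fin 3) E)
    (hA : formCongr σ P₁ ((StdForm.antidiagonal 3).over E) = (!![H₂ 0 0, 0, H₂ 0 1; 0, hW, 0; H₂ 1 0, 0, H₂ 1 1] : Matrix (Fin 3) (Fin 3) E))
    (hΓ : P₁ * endoGL (γ₂, u) * P₁⁻¹ ∈ unitaryGroupOfForm σ ((StdForm.antidiagonal 3).over E))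
    (hmcm : mcOfRecord d ≤ m) (hlamn : Valued.v (lam - 1) ≤ Valued.v (jE ϖ) ^ mcOfRecord d)
    (hun : Valued.v ((u : Matrix (Fin 1) (Fin 1) E) 0 0 - 1) ≤ Valued.v ϖ ^ mcOfRecord d)
    (hFgap : ∀ z : M, ρ z = z → Θ z = z → Valued.v (jE ϖ) < Valued.v z → Valued.v z ≤ 1 → Valued.v z = 1)
    -- the class letters of the frame
    (hdeep₂ : ∀ w : M, ρ w = w → Θ w = w → Valued.v (w - 1) ≤ Valued.v (jE ϖ) ^ (2 * d) → ∃ c : M, ρ c = c ∧ c * Θ c = w)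
    {c₀ : M} (hc₀1 : Valued.v c₀ = 1)
    (hdich : ∀ x : M, Θ x = x → Valued.v x = 1 → (∃ z : M, z * Θ z = x) ∨ ∃ z : M, z * Θ z = c₀ * x)
    (hwit : ∃ a : M, Θ a = a ∧ Valued.v a = 1 ∧ ¬ ∃ e : M, ρ e = e ∧ e * Θ e = a * ρ a)
    -- the cell
    {j : ℕ} (hbj : b ≤ j) (hjm : j + mstarOfRecord d ≤ jl)
    -- the chart
    {κ₀ ξ₀ : M} (hκ₀ : κ₀ + ρ κ₀ = 1) (hΘκ₀ : Θ κ₀ = κ₀) (hκ₀1 : Valued.v κ₀ ≤ 1) (hξ : ρ ξ₀ = -ξ₀) (hΘξ : Θ ξ₀ = ξ₀)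
    {g : ℕ} (hg1 : 1 ≤ g) (hcell : j + b + 2 * g ≤ jl) (hξv : Valued.v ξ₀ * Valued.v (jE ϖ) ^ jl = Valued.v (jE ϖ) ^ (2 * b + 2 * g))
    {μa μb R₀ γ₀ : E} (hμab : lam - jE ((u : Matrix (Fin 1) (Fin 1) E) 0 0) = jE μa + jE μb * α)
    (hR₀ : jE R₀ = α * κ₀ + ρ (α * κ₀)) (hγ₀ : jE γ₀ = ξ₀ * (α - ρ α))
    {α₁ γ₁ : E} (hα₁σ : σ α₁ = α₁) (hα₁1 : Valued.v α₁ = 1) (hγ₁σ : σ γ₁ = γ₁) (hγ₁1 : Valued.v γ₁ < 1)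
    (haff : ∀ (T W f : E), σ T = T → Valued.v T = 1 → σ W = W → Valued.v W ≤ 1 → σ f = f →
      Valued.v (T * ((μa + μb * R₀) * ((ϖ * σ ϖ) ^ b)⁻¹ + μb * γ₀ * ((ϖ * σ ϖ) ^ b)⁻¹ * W) - f * ((ϖ - σ ϖ) * ((ϖ * σ ϖ) ^ ((d - d % 2) / 2))⁻¹)) ≤
        Valued.v ϖ ^ mstarOfRecord d → normSign σ f = normSign σ T * normSign σ (α₁ + γ₁ * W))
    -- the digit system and the precision letters
    (Rd : Finset E) (hRdσ : ∀ V ∈ Rd, σ V = V) {r r₀ : ℤᵐ⁰}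
    (hRd2 : ∀ V : E, σ V = V → Valued.v V ≤ 1 → ∃ V₀ ∈ Rd, Valued.v (V - V₀) ≤ r)
    (hRd3 : ∀ V ∈ Rd, ∀ V' ∈ Rd, Valued.v (V - V') ≤ r → V = V')
    (hrfloor : Valued.v (jE ϖ) ^ (2 * b) ≤ r * Valued.v ξ₀ * Valued.v (jE ϖ ^ j * (α - ρ α)))
    (hrR : r * Valued.v ξ₀ * Valued.v (jE ϖ ^ j * (α - ρ α)) < Valued.v (jE ϖ) ^ b)
    (hr₀ : r * Valued.v ξ₀ * Valued.v (jE ϖ ^ j * (α - ρ α)) ≤ r₀ * Valued.v (jE ϖ) ^ b)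
    (hdeep : ∀ w : M, ρ w = w → Θ w = w → Valued.v (w - 1) ≤ r₀ → ∃ c : M, ρ c = c ∧ c * Θ c = w)
    (hrγ : Valued.v γ₁ * r ≤ Valued.v ϖ ^ (2 * d - 1)) :
    (((∑ᶠ Λ ∈ levelSetDep ρ Θ α (jE ϖ) h j b (lam - jE ((u : Matrix (Fin 1) (Fin 1) E) 0 0)) ∩
                      {Λ | ∃ B : Submodule 𝒪[E] (Fin 2 → E), B.toAddSubgroup.map φ = Λ ∧
                        ∃ L₃ : Submodule 𝒪[E] (Fin 3 → E), IsSelfDualLattice σ ϖ (!![H₂ 0 0, 0, H₂ 0 1; 0, hW, 0; H₂ 1 0, 0, H₂ 1 1] : Matrix (Fin 3) (Fin 3) E) L₃ ∧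
                          L₃ ⊓ LinearMap.ker ((LinearMap.proj (1 : Fin 3) : (Fin 3 → E) →ₗ[E] E).restrictScalars 𝒪[E]) =
                            B.map ((Matrix.toLin' (!![1, 0; 0, 0; 0, 1] : Matrix (Fin 3) (Fin 2) E)).restrictScalars 𝒪[E]) ∧
                          (∀ c : E, (Pi.single 1 c : Fin 3 → E) ∈ L₃ ↔ Valued.v c ≤ Valued.v ϖ ^ b) ∧
                          (LatticeNearTransvShell ϖ (d % 2) (mstarOfRecord d) ((((endoGL (γ₂, u) : GL (Fin 3) E) : Matrix (Fin 3) (Fin 3) E) - 1)) L₃ ∧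
                            {z : E | ∃ y ∈ L₃, Valued.v ((ϖ ^ (mstarOfRecord d))⁻¹ * (z - pairing σ (!![H₂ 0 0, 0, H₂ 0 1; 0, hW, 0; H₂ 1 0, 0, H₂ 1 1] : Matrix (Fin 3) (Fin 3) E) y (((((endoGL (γ₂, u) : GL (Fin 3) E) : Matrix (Fin 3) (Fin 3) E) - 1)) *ᵥ y))) ≤ 1} =
                              valueSetMod σ ϖ (mstarOfRecord d) (xPlus σ ϖ d))}, f b j Λ : ℕ) : ℤ) -
                  ((∑ᶠ Λ ∈ levelSetDep ρ Θ α (jE ϖ) h j b (lam - jE ((u : Matrix (Fin 1) (Fin 1) E) 0 0)) ∩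
                      {Λ | ∃ B : Submodule 𝒪[E] (Fin 2 → E), B.toAddSubgroup.map φ = Λ ∧
                        ∃ L₃ : Submodule 𝒪[E] (Fin 3 → E), IsSelfDualLattice σ ϖ (!![H₂ 0 0, 0, H₂ 0 1; 0, hW, 0; H₂ 1 0, 0, H₂ 1 1] : Matrix (Fin 3) (Fin 3) E) L₃ ∧
                          L₃ ⊓ LinearMap.ker ((LinearMap.proj (1 : Fin 3) : (Fin 3 → E) →ₗ[E] E).restrictScalars 𝒪[E]) =
                            B.map ((Matrix.toLin' (!![1, 0; 0, 0; 0, 1] : Matrix (Fin 3) (Fin 2) E)).restrictScalars 𝒪[E]) ∧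
                          (∀ c : E, (Pi.single 1 c : Fin 3 → E) ∈ L₃ ↔ Valued.v c ≤ Valued.v ϖ ^ b) ∧
                          (LatticeNearTransvShell ϖ (d % 2) (mcOfRecord d) ((((endoGL (γ₂, u) : GL (Fin 3) E) : Matrix (Fin 3) (Fin 3) E) - 1)) L₃ ∧
                            ¬ {z : E | ∃ y ∈ L₃, Valued.v ((ϖ ^ (mstarOfRecord d))⁻¹ * (z - pairing σ (!![H₂ 0 0, 0, H₂ 0 1; 0, hW, 0; H₂ 1 0, 0, H₂ 1 1] : Matrix (Fin 3) (Fin 3) E) y (((((endoGL (γ₂, u) : GL (Fin 3) E) : Matrix (Fin 3) (Fin 3) E) - 1)) *ᵥ y))) ≤ 1} =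
                              valueSetMod σ ϖ (mstarOfRecord d) (xPlus σ ϖ d))}, f b j Λ : ℕ) : ℤ)) *
        ((Rd.filter (fun V₀ : E => Valued.v (κ₀ + jE V₀ * ξ₀) * Valued.v (jE ϖ ^ j * (α - ρ α)) = Valued.v (jE ϖ) ^ b ∧
        ∃ e : M, ρ e = e ∧ e * Θ e = (κ₀ + jE V₀ * ξ₀) * ρ (κ₀ + jE V₀ * ξ₀) / (h * ρ h))).card : ℤ) =
      ((∑ᶠ Λ ∈ levelSetDep ρ Θ α (jE ϖ) h j b (lam - jE ((u : Matrix (Fin 1) (Fin 1) E) 0 0)), f b j Λ : ℕ) : ℤ) *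
        (normSign σ (-hW) * ∑ V ∈ (Rd.filter (fun V₀ : E => Valued.v (κ₀ + jE V₀ * ξ₀) * Valued.v (jE ϖ ^ j * (α - ρ α)) = Valued.v (jE ϖ) ^ b ∧
        ∃ e : M, ρ e = e ∧ e * Θ e = (κ₀ + jE V₀ * ξ₀) * ρ (κ₀ + jE V₀ * ξ₀) / (h * ρ h))).filter (fun _ => True), normSign σ (α₁ + γ₁ * V)) := by
  classical
  obtain ⟨hσσ, hvσ, hϖ, -, -, hd1, h2t⟩ := id hD
  obtain ⟨hϖ0, hϖlt, hjϖ0, hvjϖ0, hvjϖpos, hjϖlt, hjϖle⟩ := uniformizer_letters jE hjv hϖ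
  have hπ : Valued.v (jE ϖ) = exp (-1 : ℤ) := by rw [hjiso, hϖ]
  have hπn : ∀ n : ℕ, Valued.v (jE ϖ) ^ n = exp (-(n : ℤ)) := fun n => by rw [hπ, ← exp_nsmul, nsmul_eq_mul, mul_neg, mul_one]
  have hρj : ∀ c : E, ρ (jE c) = jE c := fun c => (hjfix _).2 ⟨c, rfl⟩
  have hm1 : mstarOfRecord d = 2 * d - 1 := by simp only [mstarOfRecord]; omega
  have hmc : mcOfRecord d = 3 * d - 2 := by simp only [mcOfRecord, mstarOfRecord]; omega
  have hdt : d ≤ tE := d_le_t_of_even hD hd0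
  have hb1 : 1 ≤ b := by omega
  have hdb : d ≤ b := by omega
  have h2v : Valued.v (2 : E) < 1 := by rw [h2t]; exact pow_lt_one₀ zero_le hϖlt (by omega)
  have hhW1 : Valued.v (jE hW) = 1 := by rw [hjiso, hhW]
  have hccv : Valued.v (jE ϖ ^ j * (α - ρ α)) = Valued.v (jE ϖ) ^ j := by rw [Valuation.map_mul, hU, mul_one, Valuation.map_pow]
  have hccA : jE ϖ ^ j * (α - ρ α) ≠ 0 := mul_ne_zero (pow_ne_zero _ hjϖ0) (sub_ne_zero.2 (Ne.symm hα))
  have hμρ : Valued.v ((lam - jE ((u : Matrix (Fin 1) (Fin 1) E) 0 0)) - ρ (lam - jE ((u : Matrix (Fin 1) (Fin 1) E) 0 0))) = Valued.v (jE ϖ) ^ jl := by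
    rw [hjl, hπn]
  have hlamj : IsOrd ρ α (jE ϖ ^ j) lam := by
    refine ⟨hvlam.le, ?_⟩
    have hlamρ : lam - ρ lam = (lam - jE ((u : Matrix (Fin 1) (Fin 1) E) 0 0)) - ρ (lam - jE ((u : Matrix (Fin 1) (Fin 1) E) 0 0)) := by
      rw [map_sub, hρj]; ring
    rw [hlamρ, hμρ, hccv]; exact pow_le_pow_right_of_le_one' hjϖle (by omega)
  have hξ0 : ξ₀ ≠ 0 := fun h0 => by
    rw [h0, Valuation.map_zero, zero_mul] at hξv; exact pow_ne_zero _ hvjϖ0 hξv.symm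
  have hξR : Valued.v (jE ϖ) ^ b ≤ Valued.v ξ₀ * Valued.v (jE ϖ ^ j * (α - ρ α)) := by
    rw [hccv]
    have h1 : Valued.v ξ₀ * Valued.v (jE ϖ) ^ j * Valued.v (jE ϖ) ^ jl = Valued.v (jE ϖ) ^ (2 * b + 2 * g + j) := by
      rw [mul_assoc, mul_comm (Valued.v (jE ϖ) ^ j), ← mul_assoc, hξv, ← pow_add]
    have h2 : Valued.v (jE ϖ) ^ b * Valued.v (jE ϖ) ^ jl ≤ Valued.v (jE ϖ) ^ (2 * b + 2 * g + j) := by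
      rw [← pow_add]; exact pow_le_pow_right_of_le_one' hjϖle (by omega)
    rw [← h1] at h2
    exact le_of_mul_le_mul_right h2 (pow_pos hvjϖpos _)
  have hξ1 : 1 ≤ Valued.v ξ₀ := by
    have h1 : 1 * Valued.v (jE ϖ) ^ jl ≤ Valued.v ξ₀ * Valued.v (jE ϖ) ^ jl := by
      rw [one_mul, hξv]; exact pow_le_pow_right_of_le_one' hjϖle (by omega)
    exact le_of_mul_le_mul_right h1 (pow_pos hvjϖpos _)
  -- the row's `hcell` (★ `levelSetDep_eq_levelSet_of_add_le`: `2b ≤ m`, `j + b ≤ jl`)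
  have hcellEq : levelSetDep ρ Θ α (jE ϖ) h j b (lam - jE ((u : Matrix (Fin 1) (Fin 1) E) 0 0)) = levelSet ρ Θ α (jE ϖ) h j b :=
    levelSetDep_eq_levelSet_of_add_le hρρ hvρ hΘΘ hΘρ hvΘ hα1 hU (hρj ϖ) hπ hh hm hjl hb1 (by omega) (by omega)
  -- (hV) ★ p863914 and the label constancy §2, as functions
  have hV : ∀ (Λ : AddSubgroup M) (x₀ : M), (x₀ ≠ 0 ∧ (∀ x, x ∈ Λ ↔ ∃ ζ, IsOrd ρ α (jE ϖ ^ j) ζ ∧ x = x₀ * ζ) ∧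
          IsOrd ρ α (jE ϖ ^ j) (dualGen ρ Θ α (jE ϖ ^ j) h x₀) ∧ ¬ IsOrd ρ α (jE ϖ ^ j) (dualGen ρ Θ α (jE ϖ ^ j) h x₀ / jE ϖ) ∧
          Valued.v (dualGen ρ Θ α (jE ϖ ^ j) h x₀) = Valued.v (jE ϖ) ^ b) →
      ∃ Ve : E, jE Ve = (ρ (h * (x₀ * Θ x₀)) / (h * (x₀ * Θ x₀) + ρ (h * (x₀ * Θ x₀))) - κ₀) / ξ₀ ∧ σ Ve = Ve ∧ Valued.v Ve ≤ 1 := fun Λ x₀ hG =>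
    exists_coord_of_gen hD jE hjv hjfix hΘj hρρ hvρ hΘΘ hΘρ hΘh hb1 hccA hFgap hκ₀ hΘκ₀ hξ hΘξ hξ0 (hκ₀1.trans hξ1) hξR Λ x₀ hG
  have hψc : ∀ Ve V' : E, σ Ve = Ve → Valued.v Ve ≤ 1 → σ V' = V' → Valued.v (Ve - V') ≤ r →
      normSign σ (α₁ + γ₁ * V') = normSign σ (α₁ + γ₁ * Ve) := fun Ve V' hσVe hVe1 hσV' hnear =>
    normSign_affine_eq_of_sub_le hD hα₁σ hα₁1 hγ₁σ hγ₁1 hrγ hσVe hVe1 hσV' hnear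
  -- THE JUNCTION: a glued vertex over a weighted member reads both shells and `VS = X₊ ↔ ψ Ve` at ANY generator's coordinate `Ve`
  have hjunc : ∀ {Λ : AddSubgroup M}, Λ ∈ levelSetDep ρ Θ α (jE ϖ) h j b (lam - jE ((u : Matrix (Fin 1) (Fin 1) E) 0 0)) →
      ∀ {B : Submodule 𝒪[E] (Fin 2 → E)}, B.toAddSubgroup.map φ = Λ → ∀ {L₃ : Submodule 𝒪[E] (Fin 3 → E)},
      IsSelfDualLattice σ ϖ (!![H₂ 0 0, 0, H₂ 0 1; 0, hW, 0; H₂ 1 0, 0, H₂ 1 1] : Matrix (Fin 3) (Fin 3) E) L₃ →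
      L₃ ⊓ LinearMap.ker ((LinearMap.proj (1 : Fin 3) : (Fin 3 → E) →ₗ[E] E).restrictScalars 𝒪[E]) =
        B.map ((Matrix.toLin' (!![1, 0; 0, 0; 0, 1] : Matrix (Fin 3) (Fin 2) E)).restrictScalars 𝒪[E]) →
      (∀ c : E, (Pi.single 1 c : Fin 3 → E) ∈ L₃ ↔ Valued.v c ≤ Valued.v ϖ ^ b) → f b j Λ ≠ 0 →
      ∀ {x₀ : M}, (x₀ ≠ 0 ∧ (∀ x, x ∈ Λ ↔ ∃ ζ, IsOrd ρ α (jE ϖ ^ j) ζ ∧ x = x₀ * ζ) ∧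
          IsOrd ρ α (jE ϖ ^ j) (dualGen ρ Θ α (jE ϖ ^ j) h x₀) ∧ ¬ IsOrd ρ α (jE ϖ ^ j) (dualGen ρ Θ α (jE ϖ ^ j) h x₀ / jE ϖ) ∧
          Valued.v (dualGen ρ Θ α (jE ϖ ^ j) h x₀) = Valued.v (jE ϖ) ^ b) → ∀ {Ve : E}, jE Ve = (ρ (h * (x₀ * Θ x₀)) / (h * (x₀ * Θ x₀) + ρ (h * (x₀ * Θ x₀))) - κ₀) / ξ₀ → σ Ve = Ve → Valued.v Ve ≤ 1 →
      LatticeNearTransvShell ϖ (d % 2) (mstarOfRecord d) ((((endoGL (γ₂, u) : GL (Fin 3) E) : Matrix (Fin 3) (Fin 3) E) - 1)) L₃ ∧ LatticeNearTransvShell ϖ (d % 2) (mcOfRecord d) ((((endoGL (γ₂, u) : GL (Fin 3) E) : Matrix (Fin 3) (Fin 3) E) - 1)) L₃ ∧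
        (({z : E | ∃ y ∈ L₃, Valued.v ((ϖ ^ (mstarOfRecord d))⁻¹ * (z - pairing σ (!![H₂ 0 0, 0, H₂ 0 1; 0, hW, 0; H₂ 1 0, 0, H₂ 1 1] : Matrix (Fin 3) (Fin 3) E) y (((((endoGL (γ₂, u) : GL (Fin 3) E) : Matrix (Fin 3) (Fin 3) E) - 1)) *ᵥ y))) ≤ 1} =
            valueSetMod σ ϖ (mstarOfRecord d) (xPlus σ ϖ d)) ↔ normSign σ (α₁ + γ₁ * Ve) = normSign σ (-hW)) := by
    intro Λ hΛ B hBΛ L₃ hL hLB htube hfne x₀ hG Ve hjVe hσVe hVe1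
    obtain ⟨hsh, x₁, w₀, V₁, hx₁, hΛx, hyO, hyp, hylev, -, hTr, -, -, hσV₁, hV₁1, -, hκ₁, hlab⟩ :=
      rowTower_vertex_letters σ ϖ d tE hD jE ρ Θ α lam hρρ hvρ hjv hjfix hΘj hΘΘ hΘρ hvΘ hα hα1 hint hvlam hU hjiso hjpow hϖmax γ₂ u m jl hm hjl hum H₂ hW hH₂ hH₂σ
        hhW hhWσ φ h hφs hφi hφo hφγ hform hΘh hh b hb2 hd0 hΘlam P₁ hA hΓ hmcm hlamn hun hFgap hbj hjm hκ₀ hΘκ₀ hκ₀1 hξ hΘξ hg1 hcell hξv hμab hR₀ hγ₀ haff hΛ hBΛ hL hLB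
        htube
    have hG₁ : (x₁ ≠ 0 ∧ (∀ x, x ∈ Λ ↔ ∃ ζ, IsOrd ρ α (jE ϖ ^ j) ζ ∧ x = x₁ * ζ) ∧
          IsOrd ρ α (jE ϖ ^ j) (dualGen ρ Θ α (jE ϖ ^ j) h x₁) ∧ ¬ IsOrd ρ α (jE ϖ ^ j) (dualGen ρ Θ α (jE ϖ ^ j) h x₁ / jE ϖ) ∧
          Valued.v (dualGen ρ Θ α (jE ϖ ^ j) h x₁) = Valued.v (jE ϖ) ^ b) := ⟨hx₁, hΛx, hyO, hyp, hylev⟩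
    -- the population constant (★ p863914 §3) turns ★ M1's label into `ψ V₁`
    have hpop := (weight_ne_zero_iff_normSign_pairing_of_gen hD h2v jE hjv hjfix hΘj hρρ hvρ hΘΘ hΘρ hvΘ hΘh hh hb1 hdb hccA hFgap hhWσ hhW1 hlamj f hf hcellEq
      Λ x₁ hG₁ hTr).1 hfne
    have hlab' := hlab.trans (normSign_mul_eq_one_iff_eq hpop (α₁ + γ₁ * V₁))
    -- the label passes from `V₁ = Vf x₁` to `Ve = Vf x₀` (§1 + §2)
    have hVf₁ : (ρ (h * (x₁ * Θ x₁)) / (h * (x₁ * Θ x₁) + ρ (h * (x₁ * Θ x₁))) - κ₀) / ξ₀ = jE V₁ := by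
      rw [hκ₁, add_sub_cancel_left, mul_div_cancel_right₀ _ hξ0]
    have hnear : Valued.v (Ve - V₁) ≤ r := by
      have h1 := v_coord_sub_coord_le_of_floor jE hjfix hjϖ0 hjϖle hρρ hvρ hΘΘ hΘρ hvΘ hΘh hb1 hccA hFgap κ₀ hξ0 hrfloor Λ x₁ x₀ hG₁ hG
      rw [← hjVe, hVf₁, ← map_sub, hjiso] at h1; exact h1
    have hψt : normSign σ (α₁ + γ₁ * V₁) = normSign σ (α₁ + γ₁ * Ve) := hψc Ve V₁ hσVe hVe1 hσV₁ hnear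
    refine ⟨?_, ?_, by rw [hlab', hψt]⟩
    · rw [hd0]; exact hsh _ (by omega) (by omega) (by omega) (by omega)
    · rw [hd0]; exact hsh _ (by omega) (by omega) (by omega) (by omega)
  -- ★ K6-0 HEAD′ with the reads by name
  refine cellDiff_mul_card_eq_cellCount_mul_signSum_of_fibration_reads₃ σ hσσ hvσ hϖ hD h2v hH₂σ hhW hhWσ jE hρρ hvρ hα hα1 hint hΘΘ hΘρ hvΘ hΘj hjv hjfix hjpow
    hϖmax φ hφs hφi hφo hφγ hvlam hΘh hh hform ((u : Matrix (Fin 1) (Fin 1) E) 0 0) hb1 hdb hlamj f hf hjiso hcellEq (hfinLS j b)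
    (fun x₀ => ∃ e : M, ρ e = e ∧ e * Θ e = h * (x₀ * Θ x₀) + ρ (h * (x₀ * Θ x₀)))
    (fun x₀ => (ρ (h * (x₀ * Θ x₀)) / (h * (x₀ * Θ x₀) + ρ (h * (x₀ * Θ x₀))) - κ₀) / ξ₀)
    (∃ e : M, ρ e = e ∧ e * Θ e = -(h * ρ h * ((α - ρ α) * Θ (α - ρ α)) * jE hW)) r Rd hRd2 hRd3
    (fun V₀ : E => Valued.v (κ₀ + jE V₀ * ξ₀) * Valued.v (jE ϖ ^ j * (α - ρ α)) = Valued.v (jE ϖ) ^ b ∧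
      ∃ e : M, ρ e = e ∧ e * Θ e = (κ₀ + jE V₀ * ξ₀) * ρ (κ₀ + jE V₀ * ξ₀) / (h * ρ h)) (fun _ => True) (fun V => normSign σ (α₁ + γ₁ * V) = normSign σ (-hW))
    (fun Λ x₀ x₀' hG hG' => ⟨cls_iff_cls_of_gen hD jE hjv hjfix hΘj hρρ hvρ hΘΘ hΘρ hvΘ hα hα1 hint hΘh hb1 hdb hbj hccA hFgap hdeep₂ Λ x₀ x₀' hG hG',
      v_coord_sub_coord_le_of_floor jE hjfix hjϖ0 hjϖle hρρ hvρ hΘΘ hΘρ hvΘ hΘh hb1 hccA hFgap κ₀ hξ0 hrfloor Λ x₀ x₀' hG hG'⟩)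
    hV
    (fun Λ x₀ V₀ hG hV₀ hnear => lit_of_near_of_gen hD jE hjv hjfix hΘj hρρ hvρ hΘΘ hΘρ hΘh hh hb1 hccA hFgap hκ₀ hΘκ₀ hξ hΘξ hξ0 hrR hr₀ hdeep Λ x₀ hG V₀
      (hRdσ V₀ hV₀) hnear)
    (fun _ _ _ _ _ _ => Iff.rfl)
    (fun Ve V₀ hσVe hVe1 hV₀ hnear => by rw [hψc Ve V₀ hσVe hVe1 (hRdσ V₀ hV₀) hnear])
    (fibre_ncard_eq_of_lit_of_gen hD jE hjiso hjfix hΘj hρρ hvρ hΘΘ hΘρ hΘh hh hb1 hccA hFgap (hfinLS j b) hc₀1 hdich hwit hκ₀ hΘκ₀ hξ hΘξ hξ0 hrR hr₀ hdeep _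
      Rd hRdσ _ (fun V _ hL => hL))
    (fun Λ => ∃ B : Submodule 𝒪[E] (Fin 2 → E), B.toAddSubgroup.map φ = Λ ∧
                        ∃ L₃ : Submodule 𝒪[E] (Fin 3 → E), IsSelfDualLattice σ ϖ (!![H₂ 0 0, 0, H₂ 0 1; 0, hW, 0; H₂ 1 0, 0, H₂ 1 1] : Matrix (Fin 3) (Fin 3) E) L₃ ∧
                          L₃ ⊓ LinearMap.ker ((LinearMap.proj (1 : Fin 3) : (Fin 3 → E) →ₗ[E] E).restrictScalars 𝒪[E]) =
                            B.map ((Matrix.toLin' (!![1, 0; 0, 0; 0, 1] : Matrix (Fin 3) (Fin 2) E)).restrictScalars 𝒪[E]) ∧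
                          (∀ c : E, (Pi.single 1 c : Fin 3 → E) ∈ L₃ ↔ Valued.v c ≤ Valued.v ϖ ^ b) ∧
                          (LatticeNearTransvShell ϖ (d % 2) (mstarOfRecord d) ((((endoGL (γ₂, u) : GL (Fin 3) E) : Matrix (Fin 3) (Fin 3) E) - 1)) L₃ ∧
                            {z : E | ∃ y ∈ L₃, Valued.v ((ϖ ^ (mstarOfRecord d))⁻¹ * (z - pairing σ (!![H₂ 0 0, 0, H₂ 0 1; 0, hW, 0; H₂ 1 0, 0, H₂ 1 1] : Matrix (Fin 3) (Fin 3) E) y (((((endoGL (γ₂, u) : GL (Fin 3) E) : Matrix (Fin 3) (Fin 3) E) - 1)) *ᵥ y))) ≤ 1} =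
                              valueSetMod σ ϖ (mstarOfRecord d) (xPlus σ ϖ d)))
    (fun Λ => ∃ B : Submodule 𝒪[E] (Fin 2 → E), B.toAddSubgroup.map φ = Λ ∧
                        ∃ L₃ : Submodule 𝒪[E] (Fin 3 → E), IsSelfDualLattice σ ϖ (!![H₂ 0 0, 0, H₂ 0 1; 0, hW, 0; H₂ 1 0, 0, H₂ 1 1] : Matrix (Fin 3) (Fin 3) E) L₃ ∧
                          L₃ ⊓ LinearMap.ker ((LinearMap.proj (1 : Fin 3) : (Fin 3 → E) →ₗ[E] E).restrictScalars 𝒪[E]) =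
                            B.map ((Matrix.toLin' (!![1, 0; 0, 0; 0, 1] : Matrix (Fin 3) (Fin 2) E)).restrictScalars 𝒪[E]) ∧
                          (∀ c : E, (Pi.single 1 c : Fin 3 → E) ∈ L₃ ↔ Valued.v c ≤ Valued.v ϖ ^ b) ∧
                          (LatticeNearTransvShell ϖ (d % 2) (mcOfRecord d) ((((endoGL (γ₂, u) : GL (Fin 3) E) : Matrix (Fin 3) (Fin 3) E) - 1)) L₃ ∧
                            ¬ {z : E | ∃ y ∈ L₃, Valued.v ((ϖ ^ (mstarOfRecord d))⁻¹ * (z - pairing σ (!![H₂ 0 0, 0, H₂ 0 1; 0, hW, 0; H₂ 1 0, 0, H₂ 1 1] : Matrix (Fin 3) (Fin 3) E) y (((((endoGL (γ₂, u) : GL (Fin 3) E) : Matrix (Fin 3) (Fin 3) E) - 1)) *ᵥ y))) ≤ 1} =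
                              valueSetMod σ ϖ (mstarOfRecord d) (xPlus σ ϖ d)))
    (fun Λ x₀ hG => weight_ne_zero_iff_cls_of_gen hD h2v jE hjv hjfix hΘj hρρ hvρ hΘΘ hΘρ hvΘ hΘh hh hb1 hdb hccA hFgap hhWσ hhW1 hlamj f hf hcellEq Λ x₀ hG)
    (fun Λ x₀ hG hfne => ?_) (fun Λ x₀ hG hfne => ?_) (normSign σ (-hW)) (fun V => normSign σ (α₁ + γ₁ * V))
    (fun V _ _ _ => ite_eq_normSign_mul_normSign σ (α₁ + γ₁ * V) (-hW))
  -- (hL₁): `P₁ Λ ↔ ∃ Ve, jE Ve = Vf x₀ ∧ ⊤ ∧ ψ Ve`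
  · have hΛ : Λ ∈ levelSetDep ρ Θ α (jE ϖ) h j b (lam - jE ((u : Matrix (Fin 1) (Fin 1) E) 0 0)) := by rw [hcellEq]; exact ⟨x₀, hG⟩
    obtain ⟨Ve, hjVe, hσVe, hVe1⟩ := hV Λ x₀ hG
    refine ⟨?_, ?_⟩
    · rintro ⟨B, hBΛ, L₃, hL, hLB, htube, -, hVS⟩
      exact ⟨Ve, hjVe, trivial, (hjunc hΛ hBΛ hL hLB htube hfne hG hjVe hσVe hVe1).2.2.1 hVS⟩
    · rintro ⟨Ve', hjVe', -, hψVe'⟩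
      obtain rfl : Ve' = Ve := jE.injective (hjVe'.trans hjVe.symm)
      obtain ⟨B, hBΛ, L₃, hL, hLB, htube⟩ := exists_glued_of_mem_levelSetDep_of_weight_ne_zero σ hσσ hvσ hϖ hH₂ hH₂σ hhW hhWσ jE hρρ hvρ hα hα1 hint hΘΘ hΘρ hvΘ
        hΘj hjv hjfix hjpow hϖmax φ hφs hφi hφo hφγ hvlam hΘh hh hform ((u : Matrix (Fin 1) (Fin 1) E) 0 0) hb1 hlamj f hf hΛ hfne
      obtain ⟨hs, -, hl⟩ := hjunc hΛ hBΛ hL hLB htube hfne hG hjVe' hσVe hVe1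
      exact ⟨B, hBΛ, L₃, hL, hLB, htube, hs, hl.2 hψVe'⟩
  -- (hL₂): `Q₁ Λ ↔ ∃ Ve, jE Ve = Vf x₀ ∧ ⊤ ∧ ¬ ψ Ve`
  · have hΛ : Λ ∈ levelSetDep ρ Θ α (jE ϖ) h j b (lam - jE ((u : Matrix (Fin 1) (Fin 1) E) 0 0)) := by rw [hcellEq]; exact ⟨x₀, hG⟩
    obtain ⟨Ve, hjVe, hσVe, hVe1⟩ := hV Λ x₀ hG
    refine ⟨?_, ?_⟩
    · rintro ⟨B, hBΛ, L₃, hL, hLB, htube, -, hVS⟩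
      exact ⟨Ve, hjVe, trivial, fun hψ => hVS ((hjunc hΛ hBΛ hL hLB htube hfne hG hjVe hσVe hVe1).2.2.2 hψ)⟩
    · rintro ⟨Ve', hjVe', -, hψVe'⟩
      obtain rfl : Ve' = Ve := jE.injective (hjVe'.trans hjVe.symm)
      obtain ⟨B, hBΛ, L₃, hL, hLB, htube⟩ := exists_glued_of_mem_levelSetDep_of_weight_ne_zero σ hσσ hvσ hϖ hH₂ hH₂σ hhW hhWσ jE hρρ hvρ hα hα1 hint hΘΘ hΘρ hvΘ
        hΘj hjv hjfix hjpow hϖmax φ hφs hφi hφo hφγ hvlam hΘh hh hform ((u : Matrix (Fin 1) (Fin 1) E) 0 0) hb1 hlamj f hf hΛ hfne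
      obtain ⟨-, hs, hl⟩ := hjunc hΛ hBΛ hL hLB htube hfne hG hjVe' hσVe hVe1
      exact ⟨B, hBΛ, L₃, hL, hLB, htube, hs, fun hVS => hψVe' (hl.1 hVS)⟩

end Summit.HodgeConjecture.HodgeConjecture.Cruxes.H413.F0P3cDyRamRowTowerCellPerCellValue

end
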